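import Mathlib.Analysis.InnerProductSpace.PiL2
import Mathlib.Tactic.LinearCombination
import HarnessLib

/-!
# Šverák's classification of `(−1)`-homogeneous steady Navier–Stokes flows — the Bernoulli algebra

Analysis/FluidPDE support file, second of the series `SverakLandau*` proving the named fact
`Literature.Analysis.FluidPDE.Sverak2011_landauClassification` (V. Šverák, J. Math. Sci. 179
(2011) = arXiv:math/0604550, Thm. 1).

The key step of Šverák's proof (§4, Lemma 1) is that the "vorticity" `ω = curl_{S²} v` of the
tangential part `v` of a `(−1)`-homogeneous steady solution `u = (v + f e_r)/r` vanishes.  In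
print this is a Fredholm-alternative argument for the linear equation `−Δω + div(vω) = 0` on
`S²`.  The series replaces it by a maximum-principle argument for the **Bernoulli function**
`K = ½|v|² + p − f` of the sphere system (S) (the quantity shown to be constant right after
Lemma 1 in print): in the `ℝ³ ∖ {0}` rendering, with `F = ⟪x, u⟫` (`= f`), the homogeneous
pressure `P` and `K = |x|² (½|u|² + P) − ½F² − F`, one has the pointwise identity

  `ΔK − ⟪u, ∇K⟫ = q²`,  `q = ⟪x, curl u⟫` (`= ω/|x|`),

so that `K` is a subsolution of the drift Laplacian `−Δ + u·∇` and E. Hopf's strong maximum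
principle (tree: `Literature.Analysis.PDE.hopf_minimumPrinciple`) makes `K` constant and
`q ≡ 0`.  The identity is the sum of the classical head-pressure identity
`−ΔH + u·∇H = −|curl u|²`, `H = ½|u|² + P` (Tsai 1998 (1.7) with `a = 0`; tree
`IsLerayProfile.driftOp_headPressure`), Euler's relations for homogeneous functions, the steady
equations dotted with `x`, and Lagrange's identity `|x|²|curl u|² = ⟪x, curl u⟫² + |x × curl u|²`
with `x × curl u = ∇F` for `(−1)`-homogeneous `u`.

This file isolates the **pure finite-sum algebra** of that computation (no calculus): given real
symbols for `x`, `u(x)`, `∂ⱼuᵢ`, `∂ₗ∂ₗuᵢ`, `∂ₗP`, `∂ₗ∂ₗP`, `P` at a point of `ℝ³`, tied by the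
coordinate forms of the steady Navier–Stokes equations, incompressibility, Euler's relations
`∑ⱼ xⱼ∂ⱼuᵢ = −uᵢ`, `∑ⱼ xⱼ∂ⱼP = −2P` and the pressure Poisson equation `ΔP = −tr((∇u)²)`, the
expressions for `∂ₗK`, `∂ₗ∂ₗK` delivered by the product rule combine to
`∑ₗ ∂ₗ∂ₗK − ∑ₗ uₗ∂ₗK = ⟪x, curl u⟫²` (`Sverak2011.bernoulliK_algebra`).  The calculus producing
these expressions, and the maximum-principle conclusion, are the next files of the series.

## References

* V. Šverák, *On Landau's solutions of the Navier–Stokes equations*, J. Math. Sci. 179 (2011)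
  208–228, arXiv:math/0604550, §4 (system (S), Lemma 1, the constant `c = ½|v|² + p − f`).
  [`Sverak2011`]
* T.-P. Tsai, *On Leray's self-similar solutions of the Navier–Stokes equations satisfying local
  energy estimates*, ARMA 143 (1998) 29–51, (1.7) (head-pressure identity). [`Tsai1998`]
-/

noncomputable section

open scoped BigOperators

namespace Literature.Analysis.FluidPDE

namespace Sverak2011

/-- **The Bernoulli algebra.**  At a point `x ∈ ℝ³` let `u = u(x)`, `d j i = ∂ⱼuᵢ`,
`dd l i = ∂ₗ∂ₗuᵢ`, `lap i = Δuᵢ`, `p₁ l = ∂ₗP`, `p₂ l = ∂ₗ∂ₗP` and `P = P(x)` satisfy the steady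
Navier–Stokes equations `∂ᵢP = Δuᵢ − ∑ⱼ uⱼ∂ⱼuᵢ`, `∑ₗ ∂ₗuₗ = 0`, Euler's relations
`∑ⱼ xⱼ ∂ⱼuᵢ = −uᵢ` (`u` homogeneous of degree `−1`), `∑ⱼ xⱼ ∂ⱼP = −2P` (`P` of degree `−2`) and
the pressure Poisson equation `∑ₗ ∂ₗ∂ₗP = −∑ₗⱼ ∂ₗuⱼ ∂ⱼuₗ`.  With `r2 = |x|²`, `U2 = |u|²`,
`F = ⟪x, u⟫`, `F₁ l = ∂ₗF = uₗ + ∑ᵢ xᵢ∂ₗuᵢ`, `F₂ l = ∂ₗ∂ₗF = 2∂ₗuₗ + ∑ᵢ xᵢ∂ₗ∂ₗuᵢ`, the product-rule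
expressions `K₁ l = ∂ₗK`, `K₂ l = ∂ₗ∂ₗK` of `K = r2 (½U2 + P) − ½F² − F` satisfy
`∑ₗ K₂ l − ∑ₗ uₗ K₁ l = ⟪x, curl u⟫²` (Šverák 2011, §4: the Bernoulli quantity `½|v|² + p − f`
of the sphere system; here the `ℝ³ ∖ {0}` form of `−Δ_{S²}K + v·∇K = −ω²`). [cite: Sverak2011, §4 Lemma 1] -/
theorem bernoulliK_algebra (x u p₁ p₂ lap F₁ F₂ K₁ K₂ : Fin 3 → ℝ) (d dd : Fin 3 → Fin 3 → ℝ)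
    (P r2 U2 F : ℝ)
    (hNS : ∀ i, p₁ i = lap i - ∑ j, u j * d j i)
    (hlap : ∀ i, lap i = ∑ l, dd l i)
    (hdiv : ∑ l, d l l = 0)
    (hEu : ∀ i, ∑ j, x j * d j i = -u i)
    (hEP : ∑ j, x j * p₁ j = -2 * P)
    (hPP : ∑ l, p₂ l = -∑ l, ∑ j, d l j * d j l)
    (hr2 : r2 = ∑ i, x i ^ 2) (hU2 : U2 = ∑ i, u i ^ 2) (hF : F = ∑ i, x i * u i)
    (hF₁ : ∀ l, F₁ l = u l + ∑ i, x i * d l i)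
    (hF₂ : ∀ l, F₂ l = 2 * d l l + ∑ i, x i * dd l i)
    (hK₁ : ∀ l, K₁ l = x l * U2 + r2 * ∑ i, u i * d l i + 2 * x l * P + r2 * p₁ l -
      (F + 1) * F₁ l)
    (hK₂ : ∀ l, K₂ l = U2 + 4 * x l * ∑ i, u i * d l i + r2 * ∑ i, d l i ^ 2 +
      r2 * ∑ i, u i * dd l i + 2 * P + 4 * x l * p₁ l + r2 * p₂ l - F₁ l ^ 2 - (F + 1) * F₂ l) :
    ∑ l, K₂ l - ∑ l, u l * K₁ l =
      (x 0 * (d 1 2 - d 2 1) + x 1 * (d 2 0 - d 0 2) + x 2 * (d 0 1 - d 1 0)) ^ 2 := by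
  simp only [Fin.sum_univ_three] at hNS hlap hdiv hEu hEP hPP hr2 hU2 hF hF₁ hF₂ hK₁ hK₂ ⊢
  simp only [hK₁, hK₂, hF₁, hF₂]
  -- eliminate `u` (Euler), `lap`, `p₁` (Navier–Stokes), `P` (Euler), `p₂ 0` (Poisson), `d 0 0`
  have hu : ∀ i, u i = -(x 0 * d 0 i + x 1 * d 1 i + x 2 * d 2 i) := fun i => by
    linarith [hEu i]
  simp only [hNS, hlap] at hEP ⊢
  subst hr2 hU2 hF
  simp only [hu] at hEP ⊢
  have hP : P = -2⁻¹ * (x 0 * (dd 0 0 + dd 1 0 + dd 2 0 -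
      (-(x 0 * d 0 0 + x 1 * d 1 0 + x 2 * d 2 0) * d 0 0 +
        -(x 0 * d 0 1 + x 1 * d 1 1 + x 2 * d 2 1) * d 1 0 +
        -(x 0 * d 0 2 + x 1 * d 1 2 + x 2 * d 2 2) * d 2 0)) +
      x 1 * (dd 0 1 + dd 1 1 + dd 2 1 -
        (-(x 0 * d 0 0 + x 1 * d 1 0 + x 2 * d 2 0) * d 0 1 +
          -(x 0 * d 0 1 + x 1 * d 1 1 + x 2 * d 2 1) * d 1 1 +
          -(x 0 * d 0 2 + x 1 * d 1 2 + x 2 * d 2 2) * d 2 1)) +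
      x 2 * (dd 0 2 + dd 1 2 + dd 2 2 -
        (-(x 0 * d 0 0 + x 1 * d 1 0 + x 2 * d 2 0) * d 0 2 +
          -(x 0 * d 0 1 + x 1 * d 1 1 + x 2 * d 2 1) * d 1 2 +
          -(x 0 * d 0 2 + x 1 * d 1 2 + x 2 * d 2 2) * d 2 2))) := by
    linarith [hEP]
  subst hP
  have hp20 : p₂ 0 = -(d 0 0 * d 0 0 + d 0 1 * d 1 0 + d 0 2 * d 2 0 +
      (d 1 0 * d 0 1 + d 1 1 * d 1 1 + d 1 2 * d 2 1) +
      (d 2 0 * d 0 2 + d 2 1 * d 1 2 + d 2 2 * d 2 2)) - p₂ 1 - p₂ 2 := by linarith [hPP]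
  have hd00 : d 0 0 = -d 1 1 - d 2 2 := by linarith [hdiv]
  rw [hp20]
  simp only [hd00]
  ring

end Sverak2011

end Literature.Analysis.FluidPDE
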